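import Literature.NumberTheory.Automorphic.ParabolicIndGLDetCharIrreducible   -- `lastBlockLabel`, `maxParabolicLeviChar` (the `Q_{2,1}` datum); brings `Representation.parabolicIndGL`
import Literature.NumberTheory.Automorphic.ParabolicInduction                 -- instance `LocallyCompactSpace (standardParabolicGL F c)` (induction from the Borel `P_id`)
import Literature.NumberTheory.Automorphic.TateLocalFactors                   -- `QuasiChar`, `unramifiedTwist F s` (the unramified character `ν^s = |·|^s`)
import HarnessLib

/-!
# Zelevinsky 1980, Thm. 6.1 (a) — the case of the one-link `GL₃` principal series `ν₀ν^{1/2} × χ′ × ν₀ν^{-1/2}` (UNITARY `ν₀, χ′`):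
# every irreducible quotient is `(ν₀ ∘ det_{GL₂}) × χ′` (named fact, stated over the tree's `Representation.parabolicIndGL`)

A. V. Zelevinsky, *Induced representations of reductive p-adic groups II. On irreducible representations of GL(n)*,
Ann. Sci. ÉNS (4) 13 (1980) 165–210 [Zelevinsky1980] (held: `paper:doi-10-24033-asens-1379`, PDF page = journal page
− 163).  Setting as in the sibling file `ParabolicIndGLDetCharIrreducible` (§1.1 p. 170: `F` local non-archimedean,
`G_n = GL(n, F)`, `ρ₁ × ρ₂ = i_{G_n, G_{(n₁,n₂)}}(ρ₁ ⊗ ρ₂)` the NORMALISED induction from the standard block UPPER triangular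
parabolic; `ν(g) = |det g|` (§3.1); segments `Δ = [ρ, ν^k ρ]` and `⟨Δ⟩` (§3.1–3.2)).

THE PRINTED STATEMENTS (verbatim from the held text):
* §4.1 (p. 184, p0021 L11–L14): «We say that `Δ₁` and `Δ₂` are linked if `Δ₁ ⊄ Δ₂`, `Δ₂ ⊄ Δ₁` and `Δ₁ ∪ Δ₂` is also a
  segment.  … If `Δ₁` and `Δ₂` are linked and `ρ₂ = ν^k ρ₁` where `k > 0` then we say that `Δ₁` precedes `Δ₂`.»
* §6.1 THEOREM (p. 188, p0025 L32–L34): «(a) Let `Δ₁, …, Δ_r` be segments in `𝒞`. Suppose for each pair of indices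
  `i, j` such that `i < j`, `Δ_i` does not precede `Δ_j` (see 4.1). Then the representation `⟨Δ₁⟩ × ⋯ × ⟨Δ_r⟩` has a unique
  irreducible submodule; denote it by `⟨Δ₁, …, Δ_r⟩`.»
* §3.1 (p. 180): `⟨Δ⟩` is the unique irreducible submodule of `ρ × νρ × ⋯ × ν^k ρ` (2.10); §3.2 Example (p. 181): «If …
  `Δ = [ρ, ρ′]` then `ω = ⟨Δ⟩ ∈ Irr G_{k+1}` is onedimensional: `ω(g) = ν^{k/2}(g)·ρ(det g)`»; and 9.1 (p. 197, p0034 L27–L36),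
  for the DUAL representation `⟨Δ⟩ᵗ`: «Another way to define `⟨Δ⟩ᵗ` is to say that `⟨Δ⟩ᵗ` is the unique irreducible submodule of
  `ρ′ × ν⁻¹ρ′ × ⋯ × ρ` (or the unique irreducible quotient of `ρ × νρ × ⋯ × ρ′`), see 2.10.»  So in the DECREASING order
  `ρ′ × ν⁻¹ρ′ × ⋯ × ρ` the submodule is `⟨Δ⟩ᵗ` (Steinberg type) and — `ρ × νρ` having exactly the two constituents `⟨Δ⟩`, `⟨Δ⟩ᵗ`
  (2.10, 4.2) — the one-dimensional `⟨Δ⟩` is the QUOTIENT.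
* §4.2 THEOREM (p. 184): «`⟨Δ₁⟩ × ⋯ × ⟨Δ_r⟩` is irreducible iff for each `i, j` the segments `Δ_i` and `Δ_j` are not linked.»

THE CASE RECORDED HERE.  `N = 3`, `ν₀, χ′` UNITARY CONTINUOUS characters of `Fˣ`, and the three one-point segments
`Δ₁ = {ν₀ν^{1/2}}`, `Δ₂ = {χ′}`, `Δ₃ = {ν₀ν^{-1/2}}` IN THIS ORDER — the normalised principal series
`I := ν₀ν^{1/2} × χ′ × ν₀ν^{-1/2} = Ind_B^{GL₃}((ν₀ν^{1/2} ⊗ χ′ ⊗ ν₀ν^{-1/2}) ⊗ δ_B^{1/2})` from the upper-triangular Borel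
(exponents `½ > 0 > −½`).  No `Δ_i` precedes a LATER `Δ_j` (`Δ₃` precedes `Δ₁`, but `3 > 1`; `χ′` unitary is linked to
neither neighbour), so by 6.1 (a) `I` has a UNIQUE irreducible submodule (`⟨Δ₁, Δ₂, Δ₃⟩`, of Steinberg type).  `I` has
length two — its other constituent is `⟨[ν₀ν^{-1/2}, ν₀ν^{1/2}]⟩ × ⟨Δ₂⟩ = (ν₀ ∘ det_{G₂}) × χ′` (§3.2 Example; irreducible
by 4.2, the companion fact `parabolicIndGL_detChar_unitary_isIrreducible`), a quotient of `I` because the decreasing product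
`ν₀ν^{1/2} × ν₀ν^{-1/2} = ρ′ × ν⁻¹ρ′` (`Δ = [ν₀ν^{-1/2}, ν₀ν^{1/2}]`) has `⟨Δ⟩ᵗ` as its submodule (9.1) and the one-dimensional
`⟨Δ⟩ = ν₀ ∘ det` as its quotient, `χ′ × ν₀ν^{-1/2} ≅ ν₀ν^{-1/2} × χ′` (unlinked, 4.2 with 1.9) and `× χ′` is exact
([BernsteinZelevinsky1977, §2.3]) — and a length-two module with a unique irreducible submodule is uniserial.  HENCE: **every irreducible QUOTIENT of `I` is isomorphic to
`(ν₀ ∘ det_{G₂}) × χ′`** — the Langlands quotient of the standard module `I`; at a place of a CM field split in the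
quadratic extension this is Rogawski's split-place member `i_G(ξ_v)` ([Rogawski1990, Lemma 4.13.1 (b), §13.1 p. 199]).

LEAN OBJECTS (all the tree's, nothing redefined): `I` = `Representation.parabolicIndGL F (id : Fin 3 → Fin 3) (𝟙.twist
(∏_a θ_a ∘ det ∘ ev_a))` at `θ = ![ν₀·ν^{1/2}, χ′, ν₀·(ν^{1/2})⁻¹]` — the currency of the tree's `GL₃` exponent calculus
(`Summits/…/K2E3GL3*`), `ν^{1/2} = (unramifiedTwist F (1/2) : QuasiChar F).toMonoidHom` (`Automorphic/TateLocalFactors.lean`);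
`(ν₀ ∘ det₂) × χ′` = `Representation.parabolicIndGL F (lastBlockLabel 3) (𝟙.twist (maxParabolicLeviChar F 3 ν₀ χ′))` (sibling
file); «irreducible quotient» = an irreducible `π` (Mathlib `Representation.IsIrreducible`) with a SURJECTIVE
`Representation.IntertwiningMap I π`; «isomorphic» = `Nonempty (π.Equiv _)` (tree `Representation.Equiv`).  UNITARITY and
CONTINUITY of `ν₀, χ′` are hypotheses needed for truth (a non-unitary `χ′` may be linked to `ν₀ν^{±1/2}`).

CONSUMER (cell hodgecm-mathlib, R90-TF S8, the (M) road to socket :299): the split-place letter (M-d) «SPLIT-LQ» —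
`Summits/HodgeConjecture/HodgeConjecture/Theorems/R90S8SplitPlaceLanglandsQuotientU3Statement.lean` transports it through
`cmSplitEquiv` to `⟦π⟧ ∈ Π(ξ_v) = {⟦splitMemberGL ν₀ χ′ ∘ cmSplitEquiv⟧}`.  In-tree road to `_holds`: the `GL₃` one-link
calculus `K2E3GL3OneLinkGeneric*` (case C1, class_B quotient).

This file: ONE NAMED FACT (D-0014; not proved here).  No `sorry`, no axiom, no instance, no notation.

## References
* [Zelevinsky1980] A. V. Zelevinsky, Ann. Sci. ÉNS 13 (1980) 165–210: §3.2 p. 181, §4.1–4.2 p. 184, Thm. 6.1 p. 188, 9.1 p. 197.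
* [BernsteinZelevinsky1977] I. N. Bernstein, A. V. Zelevinsky, Ann. Sci. ÉNS 10 (1977) 441–472: §2.3 (exactness of `i_{G,M}`).
* [Rogawski1990] J. D. Rogawski, *Automorphic Representations of Unitary Groups in Three Variables* (1990), Lemma 4.13.1 (b),
  §13.1 p. 199 (split places: `Π(ξ_v) = {i_G(ξ_v)}`).
-/

noncomputable section

namespace Literature.NumberTheory.Automorphic.Zelevinsky1980

open Literature.NumberTheory.GaloisRepresentations
open scoped MatrixGroups

/-- **[Zelevinsky1980, Thm. 6.1 (a) p. 188, with §3.2 Example p. 181, Thm. 4.2 p. 184 and 9.1 p. 197] — the one-link `GL₃`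
principal series with UNITARY letters.**  Print (6.1 (a)): «Let `Δ₁, …, Δ_r` be segments in `𝒞`. Suppose for each pair of
indices `i, j` such that `i < j`, `Δ_i` does not precede `Δ_j` (see 4.1). Then the representation `⟨Δ₁⟩ × ⋯ × ⟨Δ_r⟩` has a
unique irreducible submodule»; (9.1): «`⟨Δ⟩ᵗ` is the unique irreducible submodule of `ρ′ × ν⁻¹ρ′ × ⋯ × ρ`» (so in the decreasing
order the one-dimensional `⟨Δ⟩` is the quotient); (§3.2): «`⟨[ρ, ρ′]⟩` … is onedimensional: `ω(g) = ν^{k/2}(g)·ρ(det g)`».  THE CASE RECORDED: for a non-archimedean local field `F` and UNITARY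
CONTINUOUS characters `ν₀, χ′ : Fˣ → ℂˣ`, every irreducible representation `π` of `GL₃(F)` admitting a SURJECTIVE intertwining
map from the normalised principal series `ν₀ν^{1/2} × χ′ × ν₀ν^{-1/2}` — the tree's
`Representation.parabolicIndGL F id (𝟙.twist (∏_a θ_a ∘ det ∘ ev_a))`, `θ = ![ν₀·ν^{1/2}, χ′, ν₀·(ν^{1/2})⁻¹]`,
`ν^{1/2} = unramifiedTwist F (1/2)` — is isomorphic to `(ν₀ ∘ det_{GL₂}) × χ′` — the tree's
`Representation.parabolicIndGL F (lastBlockLabel 3) (𝟙.twist (maxParabolicLeviChar F 3 ν₀ χ′))` (`I` has length two with a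
unique irreducible submodule by 6.1 (a), hence a unique irreducible quotient, which is `⟨[ν₀ν^{-1/2}, ν₀ν^{1/2}]⟩ × ⟨[χ′]⟩`).
A named fact (D-0014), not proved here. [cite: Zelevinsky1980, Thm. 6.1 (a) p. 188; §3.2 Example p. 181; Thm. 4.2 p. 184; 9.1 p. 197] -/
def parabolicIndGL_three_oneLink_quotient_equiv_detChar : Prop :=
  ∀ (F : Type) [Field F] [ValuativeRel F] [TopologicalSpace F] [IsNonarchimedeanLocalField F]
    (ν₀ χ' : Fˣ →* ℂˣ) (_hν₀u : ∀ x, ‖((ν₀ x : ℂˣ) : ℂ)‖ = 1) (_hν₀c : Continuous fun x => ((ν₀ x : ℂˣ) : ℂ))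
    (_hχ'u : ∀ x, ‖((χ' x : ℂˣ) : ℂ)‖ = 1) (_hχ'c : Continuous fun x => ((χ' x : ℂˣ) : ℂ))
    (V : Type) [AddCommGroup V] [Module ℂ V] (π : Representation ℂ (GL (Fin 3) F) V) [π.IsIrreducible]
    (q : (Representation.parabolicIndGL F (id : Fin 3 → Fin 3)
      ((Representation.trivial ℂ (Π a : Fin 3, GL {i : Fin 3 // (id : Fin 3 → Fin 3) i = a} F) ℂ).twist
        (∏ a : Fin 3, ((![ν₀ * ((unramifiedTwist F (1 / 2) : QuasiChar F).toMonoidHom), χ', ν₀ * ((unramifiedTwist F (1 / 2) : QuasiChar F).toMonoidHom)⁻¹] :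
            Fin 3 → (Fˣ →* ℂˣ)) a).comp (Matrix.GeneralLinearGroup.det.comp (Pi.evalMonoidHom (fun a : Fin 3 => GL {i : Fin 3 // (id : Fin 3 → Fin 3) i = a} F) a))))).IntertwiningMap π),
    Function.Surjective q →
      Nonempty (π.Equiv (Representation.parabolicIndGL F (lastBlockLabel 3)
        ((Representation.trivial ℂ (Π a : Bool, GL {i : Fin 3 // lastBlockLabel 3 i = a} F) ℂ).twist (maxParabolicLeviChar F 3 ν₀ χ'))))

end Literature.NumberTheory.Automorphic.Zelevinsky1980

end
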